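import Summits.QuantumFields.BalabanUV.Beta.D1BFx.PeriodicArrays
import Literature.MathematicalPhysics.QuantumFieldTheory.Balaban1983to89.Beta.OneStepKernelFamily
import Literature.MathematicalPhysics.QuantumFieldTheory.Balaban1983to89.Beta.VolumeConvolution

/-!
# `BalabanUV.Beta.D1BFx.PeriodicArraySuperposition` — road «BF-x» for binder row D1, slot (K), chain step (I) «(A1)-PACKED», brick (B4)
# «PACKED-DICT» (`HOME/b2b-balaban-beta-d1-p2/A1-PACKED-SPEC.md` v0 §1 (A2-Mᴾ), §5 Q-A1P-3, §6): **THE PERIODIC ARRAY OF A WEIGHTED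
# SUPERPOSITION OF TRANSLATION-COVARIANT STENCILS IS THE FINITE, RESPONSE-PACKED SUM OF THE ARRAYS OF THE STENCILS OVER ONE PERIOD
# WINDOW, WITH PERIODISED WEIGHTS** — and the instance for the chain-rule vertex `OneStepResolventKernel.vertexOf`.

HONEST DEPENDENCY (cell records, verbatim): «continuum YM on T⁴ ⇐ BetaPertH ∧ nine spine estimates (0/9 proved); BetaPertH ⇐ (D1) ∧ (D4) ∧
CAP+tail; G-an2-4 gates asym, D1 and NE2/3/4.»  HONEST FRAMING (cell contract, verbatim): «discharging `BetaPertH` makes Bałaban's UV stability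
UNCONDITIONAL — a real constructive-QFT result; it is NOT the continuum limit and NOT the Clay problem.»  THIS MODULE DISCHARGES NOTHING of (K),
of D1 or of the wall: [folklore] absolutely convergent `ℤ^D` bookkeeping (Fubini for a doubly indexed exponentially dominated family, the image
decomposition `VolumeConvolution.tsum_eq_sum_tsum_imageShift`, re-indexing of image sums) over the typed objects `PeriodicArrays.arr`,
`OneStepResolventKernel.wsum`∕`vertexOf`.  No definition, no `def … : Prop`, nothing cited, 0 sorry.  0 root-level binders of row D1 discharged
(hW ∕ hR-sockets ∕ hSX-socket ∕ D1Tel ∕ D1Rep = 0); (K) NOT closed; NOT D1, NOT `BetaPertH`, NOT continuum, NOT Clay.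

ABSOLUTE RULE (cell charter, verbatim): «No internally-minted statement may enter as a cited fact. Every hypothesis is either kernel-proved in this
package or a verbatim quotation of a PUBLISHED theorem with page reference. The manuscript(s) under audit are NOT citable for their own disputed
steps — they are the thing under adjudication; programme-internal (2001/route/tribunal) claims are never citable.»

WHY (owner d1-p2, `A1-PACKED-SPEC.md` §1∕§5 Q-A1P-3, ruling ρ-g16-1 (D)).  Brick (B3) «A1-PACKED-TORUS» instantiates the stripped per-torus dictionary step
`KCombineCovColourTorus.identity_array_currency_cov_What0_stripped` with RESPONSE-PACKED jets: on the M-side the first jet must be BOTH the finite packed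
sum `Σ_k rₛ k • 𝕄₁ k` over the torus' fine bonds (so that `WardJetsFromNoether.packedWard₁` supplies its Ward letter from the per-bond letters [P1]) AND
the periodised array of the road's chain-rule vertex `(arr s (vertexOf S μ y))ˆ` (the (A2-M) dictionary shape the `ℤ^D` limits consume —
`KCombineCovStripped`'s HYPOTHESIS `hJM`).  THIS FILE is the `ℤ^D` identity that makes the two descriptions ONE: for weights `w` decaying from a centre
and a translation-covariant family of self-localised stencils `K u`,
`arr s (wsum w K) = Σ_{z ∈ one window} (Σ'_m w (ẑ + s·m)) • arr s (K ẑ)`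
— the PERIODISED WEIGHT `Σ'_m w (ẑ + s·m)` is the packing response `rₛ` of the torus bond `ẑ`, the array `arr s (K ẑ)` is the per-bond table.  The
identification of the periodised `ℋ`-weight with the torus resolvent's field–multiplier block (the KKT source line `𝕄₀ rₛ = e_{inr s}`) is NOT here
(brick (B4b), `SortedKernels` currency).

CONTENT (all [folklore]; generic dimension `D`, fibre `F`).
* §1 `arr_shiftK_period` (`arr s (shiftK (s·m) K) = arr s K`), `arr_translate_eq` (a translation-covariant family has ONE array per residue class:
  `arr s (K (ẑ + s·m)) = arr s (K ẑ)`), `arr_finset_sum_apply`.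
* §2 `summable_wsum_images` (the doubly indexed family `(u, t) ↦ w u · K u (x + s·t) (y + s·t) a b` is summable — `summable_prod_of_nonneg` on the
  majorant `C·Cₖ·e^{−δ|u−p|₁}·e^{−δ|x+st−u|₁}`, inner sums `≤ Zl D δ` by `PeriodicArrays.tsum_exp_imageShift_le`), **`arr_wsum_apply`**
  (`arr s (wsum w K) x y a b = Σ'_u w u · arr s (K u) x y a b`), **`arr_wsum_eq_sum_window`** (the displayed identity, via `tsum_eq_sum_tsum_imageShift`).
* §3 **`arr_vertexOf`**: the instance `K := S κ′`, `w := u ↦ wH κ′ μ (u − N·y)` summed over `κ′` — `arr s (vertexOf S μ y) x z a b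
  = Σ_{κ′} Σ_{ẑ} (Σ'_m wH κ′ μ (ẑ + s·m − N·y)) · arr s (S κ′ ẑ) x z a b` under `LocStencil S Cs δ`, translation covariance of `S`, and (5.10)-decay of `wH`
  (the hypothesis shape of `OneStepResolventKernel.vertexFamily_vertexOf`); **`arr_vertexOfK`**: the same for the chain-rule vertex THROUGH AN ARBITRARY
  decaying packed resolvent `K` (`OneStepKernelFamily.vertexOfK K n S`, weights `colH K n μ y κ′ u = K u (n·y) (inl κ′) (inr μ)`; hypothesis shape of
  `vertexFamily_vertexOfK`) — the form chart (III′)'s comb-dressed resolvents and the road's N-leg use.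
Unit `b2b-balaban-beta-d1-p2` (road owner, gen 16), 2026-08-22.
-/

noncomputable section

namespace Summit.QuantumFields.BalabanUV.Beta.D1BFx.PeriodicArraySuperposition

open Filter Topology
open scoped BigOperators
open Literature.MathematicalPhysics.QuantumFieldTheory.Balaban1983to89
open Literature.MathematicalPhysics.QuantumFieldTheory.Balaban1983to89.Beta
open B12Sec2to5 (l1 l1_nonneg Decay510 summable_exp_neg_l1)
open ExpKernelCalculus (MKer BiLoc shiftK Zl Zl_pos Zl_nonneg summable_exp_shift summable_exp_shift' tsum_exp_shift tsum_exp_shift'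
  l1_sub_triangle l1_sub_symm)
open KernelWard (Bdd)
open OneStepResolventKernel (wsum vertexOf Fib LocStencil bound_mono)
open OneStepKernelFamily (vertexOfK colH abs_colH_le)
open KernelSpecInstance (wH)
open Summit.QuantumFields.BalabanUV.Beta.D1BFx.PeriodicArrays (arr arr_apply imageShift_eq_add_smul tsum_exp_imageShift_le summable_arr_term bdd_arr)

variable {D : ℕ} {F : Type*}

/-! ## §1 Period shifts inside the array; one array per residue class; finite sums -/

section Shift

/-- [folklore] A period translate lands in the same image family: `(x + s·t) + s·m = x + s·(t + m)`. -/
theorem imageShift_add_smul (s : ℕ) (x t m : ExpKernelCalculus.Site D) :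
    imageShift s x t + (s : ℤ) • m = imageShift s x (t + m) := by
  funext i
  simp only [Pi.add_apply, imageShift_apply, Pi.smul_apply, smul_eq_mul]
  ring

/-- [folklore] **THE ARRAY FORGETS PERIOD SHIFTS**: `arr s (shiftK (s·m) K) = arr s K` (re-index the image sum by `t ↦ t + m`). -/
theorem arr_shiftK_period (s : ℕ) (K : MKer D F) (m : ExpKernelCalculus.Site D) : arr s (shiftK ((s : ℤ) • m) K) = arr s K := by
  funext x y a b
  simp only [arr_apply, shiftK, imageShift_add_smul]
  exact (Equiv.addRight m).tsum_eq (fun t => K (imageShift s x t) (imageShift s y t) a b)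

/-- [folklore] **ONE ARRAY PER RESIDUE CLASS**: for a translation-covariant family (`K (u + v) = shiftK (−v) (K u)`) the array of the stencil at any
image `ẑ + s·m` of a bond is the array of the stencil at `ẑ`. -/
theorem arr_translate_eq {K : ExpKernelCalculus.Site D → MKer D F} (hK : ∀ u v, K (u + v) = shiftK (-v) (K u)) (s : ℕ)
    (u m : ExpKernelCalculus.Site D) : arr s (K (imageShift s u m)) = arr s (K u) := by
  rw [imageShift_eq_add_smul, hK u ((s : ℤ) • m), show -((s : ℤ) • m) = (s : ℤ) • (-m) by rw [smul_neg], arr_shiftK_period]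

/-- [folklore] The array of a finite sum of bi-localised kernels is the sum of the arrays (entrywise; each image series converges). -/
theorem arr_finset_sum_apply {ι : Type*} (S : Finset ι) {K : ι → MKer D F} {p q : ι → ExpKernelCalculus.Site D} {C : ι → ℝ} {δ : ℝ}
    (hK : ∀ i ∈ S, BiLoc (K i) (p i) (q i) (C i) δ) (hδ : 0 < δ) (s : ℕ) [NeZero s] (x y : ExpKernelCalculus.Site D) (a b : F) :
    arr s (fun x y a b => ∑ i ∈ S, K i x y a b) x y a b = ∑ i ∈ S, arr s (K i) x y a b := by
  simp only [arr_apply]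
  exact Summable.tsum_finsetSum (fun i hi => summable_arr_term (hK i hi) hδ s x y a b)

end Shift

/-! ## §2 The array of a weighted superposition -/

section Superposition

variable {w : ExpKernelCalculus.Site D → ℝ} {K : ExpKernelCalculus.Site D → MKer D F} {C Ck δ : ℝ} {p : ExpKernelCalculus.Site D}

/-- [folklore] Termwise majorant of the doubly indexed family by a product-type weight: `|w u · K u X Y a b| ≤ C·Cₖ·e^{−δ|u−p|₁}·e^{−δ|X−u|₁}`. -/
theorem abs_wsum_image_term_le (hw : ∀ u, |w u| ≤ C * Real.exp (-δ * l1 (u - p))) (hK : ∀ u, BiLoc (K u) u u Ck δ) (hδ : 0 ≤ δ)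
    (X Y u : ExpKernelCalculus.Site D) (a b : F) :
    |w u * K u X Y a b| ≤ C * Ck * Real.exp (-δ * l1 (u - p)) * Real.exp (-δ * l1 (X - u)) := by
  rw [abs_mul]
  have h1 := hw u
  have h2 := hK u X Y a b
  have hCk : 0 ≤ Ck := (hK u).nonneg a
  calc |w u| * |K u X Y a b|
      ≤ (C * Real.exp (-δ * l1 (u - p))) * (Ck * Real.exp (-δ * (l1 (X - u) + l1 (Y - u)))) :=
        mul_le_mul h1 h2 (abs_nonneg _) ((abs_nonneg _).trans h1)
    _ ≤ (C * Real.exp (-δ * l1 (u - p))) * (Ck * Real.exp (-δ * l1 (X - u))) := by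
        refine mul_le_mul_of_nonneg_left (mul_le_mul_of_nonneg_left (Real.exp_le_exp.2 ?_) hCk) ((abs_nonneg _).trans h1)
        nlinarith [l1_nonneg (Y - u)]
    _ = C * Ck * Real.exp (-δ * l1 (u - p)) * Real.exp (-δ * l1 (X - u)) := by ring

/-- [folklore] **THE DOUBLY INDEXED FAMILY IS SUMMABLE**: `(u, t) ↦ w u · K u (x + s·t) (y + s·t) a b` is summable on `ℤ^D × ℤ^D` (majorant
`C·Cₖ·e^{−δ|u−p|₁}·e^{−δ|x+st−u|₁}`: for each `u` the image sum is `≤ Zl D δ` by `PeriodicArrays.tsum_exp_imageShift_le`, then the `u`-sum converges). -/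
theorem summable_wsum_images (hw : ∀ u, |w u| ≤ C * Real.exp (-δ * l1 (u - p))) (hK : ∀ u, BiLoc (K u) u u Ck δ) (hδ : 0 < δ)
    (hC : 0 ≤ C) (s : ℕ) [NeZero s] (x y : ExpKernelCalculus.Site D) (a b : F) :
    Summable fun ut : ExpKernelCalculus.Site D × ExpKernelCalculus.Site D =>
      w ut.1 * K ut.1 (imageShift s x ut.2) (imageShift s y ut.2) a b := by
  have hCk : 0 ≤ Ck := (hK p).nonneg a
  set M : ExpKernelCalculus.Site D × ExpKernelCalculus.Site D → ℝ :=
    fun ut => C * Ck * Real.exp (-δ * l1 (ut.1 - p)) * Real.exp (-δ * l1 (imageShift s x ut.2 - ut.1)) with hMdef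
  have hM0 : 0 ≤ M := fun ut => by positivity
  have hMs : Summable M := by
    refine (summable_prod_of_nonneg hM0).2 ⟨fun u => ?_, ?_⟩
    · exact ((tsum_exp_imageShift_le hδ s x u).1).mul_left (C * Ck * Real.exp (-δ * l1 (u - p)))
    · refine Summable.of_nonneg_of_le (fun u => tsum_nonneg fun t => hM0 (u, t)) (fun u => ?_)
        ((summable_exp_shift' hδ p).mul_left (C * Ck * Zl D δ))
      have h := (tsum_exp_imageShift_le hδ s x u).2
      have hpos : 0 ≤ C * Ck * Real.exp (-δ * l1 (u - p)) := by positivity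
      calc ∑' t, M (u, t) = C * Ck * Real.exp (-δ * l1 (u - p)) * ∑' t, Real.exp (-δ * l1 (imageShift s x t - u)) := by
            rw [← tsum_mul_left]
        _ ≤ C * Ck * Real.exp (-δ * l1 (u - p)) * Zl D δ := mul_le_mul_of_nonneg_left h hpos
        _ = C * Ck * Zl D δ * Real.exp (-δ * l1 (u - p)) := by ring
  refine Summable.of_norm_bounded hMs fun ut => ?_
  rw [Real.norm_eq_abs]
  exact abs_wsum_image_term_le hw hK hδ.le _ _ _ a b

/-- [folklore] **THE ARRAY OF A WEIGHTED SUPERPOSITION, STENCIL BY STENCIL**: `arr s (wsum w K) x y a b = Σ'_u w u · arr s (K u) x y a b`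
(Fubini on `summable_wsum_images`). -/
theorem arr_wsum_apply (hw : ∀ u, |w u| ≤ C * Real.exp (-δ * l1 (u - p))) (hK : ∀ u, BiLoc (K u) u u Ck δ) (hδ : 0 < δ)
    (hC : 0 ≤ C) (s : ℕ) [NeZero s] (x y : ExpKernelCalculus.Site D) (a b : F) :
    arr s (wsum w K) x y a b = ∑' u, w u * arr s (K u) x y a b := by
  have hS := summable_wsum_images hw hK hδ hC s x y a b
  calc arr s (wsum w K) x y a b = ∑' t, ∑' u, w u * K u (imageShift s x t) (imageShift s y t) a b := by
        simp only [arr_apply, wsum]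
    _ = ∑' u, ∑' t, w u * K u (imageShift s x t) (imageShift s y t) a b := hS.tsum_comm
    _ = ∑' u, w u * arr s (K u) x y a b := tsum_congr fun u => by rw [tsum_mul_left, arr_apply]

/-- [folklore] The single series `u ↦ w u · arr s (K u) x y a b` is summable (the arrays are uniformly bounded by `Cₖ·Zl D (δ∕2)`, `PeriodicArrays.bdd_arr`). -/
theorem summable_wsum_arr (hw : ∀ u, |w u| ≤ C * Real.exp (-δ * l1 (u - p))) (hK : ∀ u, BiLoc (K u) u u Ck δ) (hδ : 0 < δ)
    (s : ℕ) [NeZero s] (x y : ExpKernelCalculus.Site D) (a b : F) :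
    Summable fun u => w u * arr s (K u) x y a b := by
  refine Summable.of_norm_bounded ((summable_exp_shift' hδ p).mul_left (C * (Ck * Zl D (δ / 2)))) fun u => ?_
  rw [Real.norm_eq_abs, abs_mul]
  have hb := bdd_arr (hK u) hδ s x y a b
  have h0 : l1 (u - u) = 0 := by simp [B12Sec2to5.l1]
  rw [h0, mul_zero, Real.exp_zero, mul_one] at hb
  calc |w u| * |arr s (K u) x y a b| ≤ (C * Real.exp (-δ * l1 (u - p))) * (Ck * Zl D (δ / 2)) :=
        mul_le_mul (hw u) hb (abs_nonneg _) ((abs_nonneg _).trans (hw u))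
    _ = C * (Ck * Zl D (δ / 2)) * Real.exp (-δ * l1 (u - p)) := by ring

/-- [folklore] **«PACKED-DICT», `ℤ^D` FORM — THE ARRAY OF A WEIGHTED SUPERPOSITION OF TRANSLATION-COVARIANT STENCILS IS THE FINITE WINDOW SUM OF
THE STENCILS' ARRAYS WITH PERIODISED WEIGHTS**: for weights `|w u| ≤ C·e^{−δ|u−p|₁}`, self-localised stencils `BiLoc (K u) u u Cₖ δ` (`δ > 0`) with
`K (u + v) = shiftK (−v) (K u)`, and any period `s ≥ 1`,
`arr s (wsum w K) x y a b = Σ_{z : Site D s} (Σ'_m w (ẑ + s·m)) · arr s (K ẑ) x y a b`, `ẑ = windowMap D s z`.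
On the torus of period `s` this reads: the periodised packed jet is `Σ_{bonds ẑ of the torus} r(ẑ) • (per-bond table)`, `r` = the periodised weight. -/
theorem arr_wsum_eq_sum_window (hw : ∀ u, |w u| ≤ C * Real.exp (-δ * l1 (u - p))) (hK : ∀ u, BiLoc (K u) u u Ck δ)
    (hKcov : ∀ u v, K (u + v) = shiftK (-v) (K u)) (hδ : 0 < δ) (hC : 0 ≤ C) (s : ℕ) [NeZero s] (x y : ExpKernelCalculus.Site D)
    (a b : F) :
    arr s (wsum w K) x y a b
      = ∑ z : Beta.Site D s, (∑' m : ExpKernelCalculus.Site D, w (imageShift s (windowMap D s z) m)) * arr s (K (windowMap D s z)) x y a b := by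
  rw [arr_wsum_apply hw hK hδ hC s x y a b, tsum_eq_sum_tsum_imageShift (s := s) (summable_wsum_arr hw hK hδ s x y a b)]
  refine Finset.sum_congr rfl fun z _ => ?_
  rw [← tsum_mul_right]
  exact tsum_congr fun m => by rw [arr_translate_eq hKcov]

end Superposition

/-! ## §3 The chain-rule vertex of the road -/

section Vertex

variable {d n : ℕ} [NeZero n]

/-- [folklore] **«PACKED-DICT» FOR THE CHAIN-RULE VERTEX** (`A1-PACKED-SPEC` §1 (A2-Mᴾ), Q-A1P-3): for a self-localised (`LocStencil S Cs δ`, `δ > 0`),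
fine-translation-covariant stencil family `S` and the (5.10)-decaying minimiser weights `wH` (hypothesis shape of
`OneStepResolventKernel.vertexFamily_vertexOf`), on every period `s ≥ 1` and at every coarse bond `(μ, y)`:
`arr s (vertexOf S μ y) x z a b = Σ_{κ′} Σ_{ẑ : Site (d+1) s} (Σ'_m wH κ′ μ (ẑ + s·m − n·y)) · arr s (S κ′ ẑ) x z a b`
— the array of the road's packed first jet is the finite sum, over the torus' fine bonds `(ẑ, κ′)`, of the PERIODISED `ℋ`-RESPONSE times the array
of the single-bond stencil.  (The identification of the periodised `ℋ`-weight with the torus resolvent's field–multiplier block is brick (B4b), not here.) -/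
theorem arr_vertexOf {S : Fin (d + 1) → ExpKernelCalculus.Site (d + 1) → MKer (d + 1) (Fib d)} {Cs δ Cw δw : ℝ}
    (hS : LocStencil S Cs δ) (hδ : 0 < δ) (hScov : ∀ κ' u v, S κ' (u + v) = shiftK (-v) (S κ' u))
    (hCw : 0 ≤ Cw) (hδw : δ ≤ δw) (hwH : ∀ κ l : Fin (d + 1), Decay510 (wH (N := n) κ l) Cw δw)
    (s : ℕ) [NeZero s] (μ : Fin (d + 1)) (y x z : ExpKernelCalculus.Site (d + 1)) (a b : Fib d) :
    arr s (vertexOf (N := n) S μ y) x z a b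
      = ∑ κ' : Fin (d + 1), ∑ zz : Beta.Site (d + 1) s,
          (∑' m : ExpKernelCalculus.Site (d + 1), wH (N := n) κ' μ (imageShift s (windowMap (d + 1) s zz) m - (n : ℤ) • y))
            * arr s (S κ' (windowMap (d + 1) s zz)) x z a b := by
  -- the weights of each direction `κ′` decay from the centre `n·y` at rate `δ`
  have hw : ∀ κ' : Fin (d + 1), ∀ u, |wH (N := n) κ' μ (u - (n : ℤ) • y)| ≤ Cw * Real.exp (-δ * l1 (u - (n : ℤ) • y)) :=
    fun κ' u => bound_mono (hwH κ' μ (u - (n : ℤ) • y)) hCw le_rfl hδw (l1_nonneg _)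
  -- each direction's superposition is bi-localised, so the finite `κ′`-sum passes through the array
  have hterm : ∀ κ' ∈ (Finset.univ : Finset (Fin (d + 1))),
      BiLoc (wsum (fun u => wH (N := n) κ' μ (u - (n : ℤ) • y)) (S κ')) ((n : ℤ) • y) ((n : ℤ) • y) (Cw * Cs * Zl (d + 1) (δ / 2)) (δ / 2) :=
    fun κ' _ => OneStepResolventKernel.biLoc_wsum (hw κ') (fun u => hS κ' u) hδ hCw
  have h1 : arr s (vertexOf (N := n) S μ y) x z a b
      = ∑ κ' : Fin (d + 1), arr s (wsum (fun u => wH (N := n) κ' μ (u - (n : ℤ) • y)) (S κ')) x z a b := by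
    have e : vertexOf (N := n) S μ y = fun x z a b => ∑ κ' ∈ (Finset.univ : Finset (Fin (d + 1))),
        wsum (fun u => wH (N := n) κ' μ (u - (n : ℤ) • y)) (S κ') x z a b := rfl
    rw [e, arr_finset_sum_apply Finset.univ hterm (half_pos hδ) s x z a b]
  rw [h1]
  exact Finset.sum_congr rfl fun κ' _ => arr_wsum_eq_sum_window (hw κ') (fun u => hS κ' u) (hScov κ') hδ hCw s x z a b

omit [NeZero n] in
/-- [folklore] **«PACKED-DICT» FOR THE CHAIN-RULE VERTEX THROUGH AN ARBITRARY PACKED RESOLVENT** `K` (`OneStepKernelFamily.vertexOfK`; hypothesis shape of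
`vertexFamily_vertexOfK`): for `Decays K C δK`, a self-localised fine-translation-covariant stencil family `S` at a rate `δ ≤ δK`, `δ > 0`, every period
`s ≥ 1` and coarse bond `(μ, y)`:
`arr s (vertexOfK K n S μ y) x z a b = Σ_{κ′} Σ_{ẑ : Site (d+1) s} (Σ'_m colH K n μ y κ′ (ẑ + s·m)) · arr s (S κ′ ẑ) x z a b`
— the periodised `ℋ`-COLUMN OF `K` as the packing response (the comb-dressed resolvents of chart (III′) and the road's N-leg are such `K`). -/
theorem arr_vertexOfK {K : MKer (d + 1) (Fib d)} {C δK : ℝ} (hK : ExpKernelCalculus.Decays K C δK) (hC : 0 ≤ C)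
    {S : Fin (d + 1) → ExpKernelCalculus.Site (d + 1) → MKer (d + 1) (Fib d)} {Cs δ : ℝ}
    (hS : LocStencil S Cs δ) (hδ : 0 < δ) (hδK : δ ≤ δK) (hScov : ∀ κ' u v, S κ' (u + v) = shiftK (-v) (S κ' u))
    (s : ℕ) [NeZero s] (μ : Fin (d + 1)) (y x z : ExpKernelCalculus.Site (d + 1)) (a b : Fib d) :
    arr s (vertexOfK K n S μ y) x z a b
      = ∑ κ' : Fin (d + 1), ∑ zz : Beta.Site (d + 1) s,
          (∑' m : ExpKernelCalculus.Site (d + 1), colH K n μ y κ' (imageShift s (windowMap (d + 1) s zz) m))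
            * arr s (S κ' (windowMap (d + 1) s zz)) x z a b := by
  have hw : ∀ κ' : Fin (d + 1), ∀ u, |colH K n μ y κ' u| ≤ C * Real.exp (-δ * l1 (u - (n : ℤ) • y)) :=
    fun κ' u => bound_mono (abs_colH_le (N := n) hK μ y κ' u) hC le_rfl hδK (l1_nonneg _)
  have hterm : ∀ κ' ∈ (Finset.univ : Finset (Fin (d + 1))),
      BiLoc (wsum (colH K n μ y κ') (S κ')) ((n : ℤ) • y) ((n : ℤ) • y) (C * Cs * Zl (d + 1) (δ / 2)) (δ / 2) :=
    fun κ' _ => OneStepResolventKernel.biLoc_wsum (hw κ') (fun u => hS κ' u) hδ hC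
  have h1 : arr s (vertexOfK K n S μ y) x z a b = ∑ κ' : Fin (d + 1), arr s (wsum (colH K n μ y κ') (S κ')) x z a b := by
    have e : vertexOfK K n S μ y = fun x z a b => ∑ κ' ∈ (Finset.univ : Finset (Fin (d + 1))), wsum (colH K n μ y κ') (S κ') x z a b := rfl
    rw [e, arr_finset_sum_apply Finset.univ hterm (half_pos hδ) s x z a b]
  rw [h1]
  exact Finset.sum_congr rfl fun κ' _ => arr_wsum_eq_sum_window (hw κ') (fun u => hS κ' u) (hScov κ') hδ hC s x z a b

end Vertex


end Summit.QuantumFields.BalabanUV.Beta.D1BFx.PeriodicArraySuperposition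

end
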